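import Mathlib
import Summits.ValiantsHypothesis.ValiantsHypothesis.Theses.ValuativeGCT
import Summits.ValiantsHypothesis.ValiantsHypothesis.Theorems.ValuativeGCTNoValuativeFlipSupportTransfer
import Summits.ValiantsHypothesis.ValiantsHypothesis.Theorems.ValuativeGCTNoValuativeFlipDetReprSize
import Summits.ValiantsHypothesis.ValiantsHypothesis.Theorems.ValuativeGCTNoValuativeFlipBeyondGrenet
import Literature.Computability.AlgebraicComplexity.OrbitClosureProofs
import Literature.NumberTheory.DiophantineGeometry.SchurWeylPlethysmRenameProofs
import Literature.NumberTheory.DiophantineGeometry.GLHighestWeightFacts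

/-!
# `NoValuativeFlip` (stmt-ValiantsHypothesis-12629) on shapes of bounded length

Route `ValuativeGCT`, support item `NoValuativeFlip` (kill statement: beyond some polynomial
padding `m ≥ n ^ c₀`, `mult_{λ*} ℂ[Δ(X₀₀^(m-n) per_n)] ≤ dim T_U(λ)` for every truncation and every
shape `λ`). Main results (unconditional except where `ValuativeBound` is named):

* `linSubst_paddedPerFormLex_mem_orbitClosure_detFormLex` — every substitution of the padded
  permanent by linear forms in a set `S` of variables, `ℓ^(m-n) per_n(L)`, lies in `Δ(det_m)` as
  soon as `m ≥ 1 + n (n + 1)^|S|`: `per_n(L)` is a form of degree `n` in `|S|` variables, so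
  `dc ≤ 1 + n (n + 1)^|S|` (Valiant universality with the monomial-expansion size,
  `hasDetRepr_of_isHomogeneous_of_le`), and Mulmuley–Sohoni homogenisation
  (`X_pow_mul_rename_mem_endOrbit_detPoly`) followed by the substitution `X ↦ ℓ` puts
  `ℓ^(m-n) per_n(L)` in `End · det_m ⊆ Δ(det_m)`.
* `orbitMultiplicity_paddedPer_le_det_of_weight_support` — hence (support transfer,
  `orbitMultiplicity_le_of_weight_support`) NO MULTIPLICITY OBSTRUCTION at weights supported on
  such an `S`: `mult_χ ℂ[Δ(X₀₀^(m-n) per_n)] ≤ mult_χ ℂ[Δ(det_m)]`.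
* `orbitMultiplicity_paddedPer_le_det_of_card_parts` — in particular for `χ = λ*` with
  `m ≥ 1 + n (n + 1)^{ℓ(λ)}` (the dual weight of `λ` lives on the last `ℓ(λ)` indices): shapes of
  BOUNDED LENGTH carry no multiplicity obstruction at POLYNOMIAL padding `m ≥ n^{ℓ(λ)+2}`
  (`n ≥ 2^{ℓ(λ)} + 1`).
* `noValuativeFlip_boundedLength` — with the route's `ValuativeBound`: for every `ρ`,
  `NoValuativeFlip` restricted to shapes with at most `ρ` parts holds with `c₀ = ρ + 2`,
  `n₀ = 2^ρ + 1`. So a valuative flip (crux `ValuativeFlip`) at padding `n ^ c` needs shapes with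
  more than `c - 2` rows: the number of rows of flip witnesses must grow with the padding exponent
  (between this bound and the Kadish–Landsberg / BIP ceiling `ℓ(λ) ≤ n² + 1`,
  file `ValuativeGCTNoValuativeFlipOutsideKL`).

This is the "inheritance" observation (BLMW 2011 §5.3; Landsberg 2017 §8.4; recorded for this
route by the `ValuativeFlip` lead, `Cruxes/ValuativeFlip/LeadCensus-c1.md` §5) made into theorems.

Sources: L. G. Valiant, STOC 1979, §2; K. Mulmuley, M. Sohoni, SIAM J. Comput. 31 (2001),
Prop. 4.4; BLMW, SIAM J. Comput. 40 (2011), §5.3; J. M. Landsberg, *Geometry and Complexity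
Theory* (2017), §8.4; H. Kadish, J. M. Landsberg, Comm. Algebra 42 (2014).
-/

-- `Summit.ValiantsHypothesis.ValiantsHypothesis.…` repeats a component by the D-0017 layout
-- (single-conjunct summit), which the `dupNamespace` linter flags; the name is mandated.
set_option linter.dupNamespace false

noncomputable section

namespace Summit.ValiantsHypothesis.ValiantsHypothesis.Theorems.NoValuativeFlip

open MvPolynomial
open Literature.NumberTheory.DiophantineGeometry Literature.Computability.AlgebraicComplexity
open Summit.ValiantsHypothesis.ValiantsHypothesis.Theses.ValuativeGCT

/-- **Substitutions of the padded permanent by forms in few variables are border-determinantal.**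
Let `n ≤ m`, `S` a set of matrix positions with `|S| + 1 ≤ m²` and `1 + n (n + 1)^|S| ≤ m`. For
every matrix `A` whose rows outside `S` vanish — so that `A · X₀₀ = ℓ` and the `A · X_ij` are linear
forms in the variables `S` — the substituted padded permanent `A · (X₀₀^(m-n) per_n) = ℓ^(m-n) per_n(L)`
lies in `Δ(det_m)` (G20 variables `Fin m × Fin m`). Proof: `per_n(L)` is `q(X_S)` for a form `q`
of degree `n` in `|S|` variables, `dc(q) ≤ 1 + n (n + 1)^|S| ≤ m`
(`hasDetRepr_of_isHomogeneous_of_le`); homogenising with a fresh position `y ∉ S`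
(`X_pow_mul_rename_mem_endOrbit_detPoly`, Mulmuley–Sohoni 2001 Prop. 4.4) gives
`X_y^(m-n) q(X_S) ∈ End · det_m`, and the substitution `X_y ↦ ℓ`, `X_S ↦ X_S` maps it to
`ℓ^(m-n) per_n(L)` inside `End · det_m ⊆ Δ(det_m)` (`endOrbit_subset_orbitClosure_holds`). -/
theorem linSubst_paddedPerPoly_mem_orbitClosure_detPoly {n m : ℕ} [NeZero m] (hnm : n ≤ m)
    (S : Finset (Fin m × Fin m)) (hm : 1 + n * (n + 1) ^ S.card ≤ m) (hS1 : S.card + 1 ≤ m * m)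
    (A : Matrix (Fin m × Fin m) (Fin m × Fin m) ℂ) (hA : ∀ i, i ∉ S → ∀ j, A i j = 0) :
    linSubst (Fin m × Fin m) ℂ A (paddedPerPoly ℂ n m) ∈ orbitClosure (detPoly (Fin m) ℂ) := by
  classical
  -- enumerate `S` and pick a fresh position `y ∉ S`
  set ρ : ℕ := S.card with hρ
  let s : Fin ρ → Fin m × Fin m := fun t => ((S.equivFin.symm t : S) : Fin m × Fin m)
  have hs_mem : ∀ t, s t ∈ S := fun t => (S.equivFin.symm t).2
  have hs_inj : Function.Injective s := fun t t' h =>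
    S.equivFin.symm.injective (Subtype.ext h)
  obtain ⟨y, hy⟩ : ∃ y : Fin m × Fin m, y ∉ S := by
    by_contra h
    simp only [not_exists, not_not] at h
    have hS : S = Finset.univ := Finset.eq_univ_iff_forall.mpr h
    have := congrArg Finset.card hS
    rw [Finset.card_univ, Fintype.card_prod, Fintype.card_fin] at this
    omega
  have hys : ∀ t, s t ≠ y := fun t h => hy (h ▸ hs_mem t)
  -- the form `q` in `ρ` variables with `q(X_S) = per_n(L)`
  let blk : BlockIdx n m × BlockIdx n m → Fin m × Fin m := fun ij => ((ij.1 : Fin m), (ij.2 : Fin m))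
  let L : BlockIdx n m × BlockIdx n m → MvPolynomial (Fin ρ) ℂ := fun ab => ∑ t, A (s t) (blk ab) • X t
  let q : MvPolynomial (Fin ρ) ℂ := aeval L (perPoly (BlockIdx n m) ℂ)
  have hL : ∀ ab, (L ab).IsHomogeneous 1 := fun ab =>
    (mem_homogeneousSubmodule 1 _).mp <| Submodule.sum_mem _ fun t _ =>
      Submodule.smul_mem _ _ ((mem_homogeneousSubmodule 1 _).mpr (isHomogeneous_X ℂ t))
  have hq : q.IsHomogeneous n := by
    have hper : (perPoly (BlockIdx n m) ℂ).IsHomogeneous n := by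
      simpa [card_blockIdx hnm] using (perPoly_isHomogeneous (n := BlockIdx n m) (k := ℂ))
    show (aeval L (perPoly (BlockIdx n m) ℂ)).IsHomogeneous n
    simpa only [one_mul] using hper.aeval L hL
  have hqrepr : HasDetRepr q m :=
    hasDetRepr_of_isHomogeneous_of_le hq (by simpa only [Fintype.card_fin] using hm)
  -- the sums `A · X_b` only involve the variables `S`
  have hsum : ∀ b : Fin m × Fin m,
      (∑ j, A j b • (X j : MvPolynomial (Fin m × Fin m) ℂ)) = ∑ t : Fin ρ, A (s t) b • X (s t) := by
    intro b
    calc (∑ j, A j b • (X j : MvPolynomial (Fin m × Fin m) ℂ))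
          = ∑ j ∈ S, A j b • (X j : MvPolynomial (Fin m × Fin m) ℂ) :=
          (Finset.sum_subset (Finset.subset_univ S) fun j _ hj => by rw [hA j hj b, zero_smul]).symm
      _ = ∑ j : S, A (j : Fin m × Fin m) b • (X (j : Fin m × Fin m) : MvPolynomial _ ℂ) :=
          (Finset.sum_coe_sort S _).symm
      _ = ∑ t : Fin ρ, A (s t) b • X (s t) := by rw [← Equiv.sum_comp S.equivFin.symm]
  -- `A · pp = ℓ^(m-n) * q(X_S)` with `ℓ = A · X₀₀`
  have hkey : linSubst (Fin m × Fin m) ℂ A (paddedPerPoly ℂ n m) =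
      linSubst (Fin m × Fin m) ℂ A (X ((0 : Fin m), (0 : Fin m))) ^ (m - n) * rename s q := by
    rw [paddedPerPoly, map_mul, map_pow]
    congr 1
    have H : (linSubst (Fin m × Fin m) ℂ A).comp (rename blk) =
        ((rename s).comp (aeval L) : MvPolynomial (BlockIdx n m × BlockIdx n m) ℂ →ₐ[ℂ] _) := by
      apply MvPolynomial.algHom_ext
      intro ab
      simp only [AlgHom.comp_apply, rename_X, aeval_X, linSubst_X, L, map_sum, map_smul]
      exact hsum (blk ab)
    exact congrArg (fun φ => φ (perPoly (BlockIdx n m) ℂ)) H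
  -- homogenisation: `X_y^(m-n) * q(X_S) ∈ End · det_m`
  obtain ⟨M, hM⟩ := X_pow_mul_rename_mem_endOrbit_detPoly hq hnm hqrepr s y
  have hMdet : linSubst (Fin m × Fin m) ℂ M (detPoly (Fin m) ℂ) = X y ^ (m - n) * rename s q := hM
  -- the substitution `X_y ↦ ℓ`, `X_(s t) ↦ X_(s t)`, other variables `↦ 0`
  let M' : Matrix (Fin m × Fin m) (Fin m × Fin m) ℂ := fun i c =>
    if c = y then A i ((0 : Fin m), (0 : Fin m)) else if c ∈ Set.range s ∧ i = c then 1 else 0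
  have hM'y : linSubst (Fin m × Fin m) ℂ M' (X y) =
      linSubst (Fin m × Fin m) ℂ A (X ((0 : Fin m), (0 : Fin m))) := by
    rw [linSubst_X, linSubst_X]
    simp [M']
  have hM's : ∀ t, linSubst (Fin m × Fin m) ℂ M' (X (s t)) = X (s t) := by
    intro t
    rw [linSubst_X, Finset.sum_eq_single (s t)]
    · simp [M', hys t]
    · intro j _ hj
      have : M' j (s t) = 0 := by
        simp only [M', if_neg (hys t)]
        rw [if_neg]
        exact fun h => hj h.2
      rw [this, zero_smul]
    · exact fun h => absurd (Finset.mem_univ _) h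
  have hM'q : linSubst (Fin m × Fin m) ℂ M' (rename s q) = rename s q := by
    have H : (linSubst (Fin m × Fin m) ℂ M').comp (rename s) =
        (rename s : MvPolynomial (Fin ρ) ℂ →ₐ[ℂ] MvPolynomial (Fin m × Fin m) ℂ) := by
      apply MvPolynomial.algHom_ext
      intro t
      simp only [AlgHom.comp_apply, rename_X, hM's]
    exact congrArg (fun φ => φ q) H
  have hfinal : linSubst (Fin m × Fin m) ℂ A (paddedPerPoly ℂ n m) =
      linSubst (Fin m × Fin m) ℂ (M' * M) (detPoly (Fin m) ℂ) := by
    rw [linSubst_mul, AlgHom.comp_apply, hMdet, map_mul, map_pow, hM'y, hM'q, hkey]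
  rw [hfinal]
  exact endOrbit_subset_orbitClosure_holds _ ⟨M' * M, rfl⟩

/-- The same in the lexicographically ordered variables `MatIdx m` (transport along
`rename toLex`: `rename_linSubst`, `rename_mem_orbitClosure_rename`). -/
theorem linSubst_paddedPerFormLex_mem_orbitClosure_detFormLex {n m : ℕ} [NeZero m] (hnm : n ≤ m)
    (S : Finset (MatIdx m)) (hm : 1 + n * (n + 1) ^ S.card ≤ m) (hS1 : S.card + 1 ≤ m * m)
    (A : Matrix (MatIdx m) (MatIdx m) ℂ) (hA : ∀ i, i ∉ S → ∀ j, A i j = 0) :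
    linSubst (MatIdx m) ℂ A (paddedPerFormLex ℂ n m) ∈ orbitClosure (detFormLex ℂ m) := by
  classical
  set e : Fin m × Fin m ≃ MatIdx m := toLex with he
  set A₀ : Matrix (Fin m × Fin m) (Fin m × Fin m) ℂ := Matrix.reindex e.symm e.symm A with hA₀
  have hAe : A = Matrix.reindex e e A₀ := by
    rw [hA₀, ← Matrix.reindex_symm, Equiv.apply_symm_apply]
  have hS₀ : ∀ i, i ∉ S.map e.symm.toEmbedding → ∀ j, A₀ i j = 0 := by
    intro i hi j
    rw [hA₀, Matrix.reindex_apply, Matrix.submatrix_apply, Equiv.symm_symm]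
    refine hA (e i) (fun h => hi ?_) (e j)
    exact Finset.mem_map.mpr ⟨e i, h, by simp⟩
  have hcard : (S.map e.symm.toEmbedding).card = S.card := Finset.card_map _
  have hmem := linSubst_paddedPerPoly_mem_orbitClosure_detPoly hnm (S.map e.symm.toEmbedding)
    (by rw [hcard]; exact hm) (by rw [hcard]; exact hS1) A₀ hS₀
  have := rename_mem_orbitClosure_rename e hmem
  rw [rename_linSubst, ← hAe] at this
  exact this

/-- **No multiplicity obstruction at weights of small support.** For `n ≤ m`, a set `S` of matrix
positions with `1 + n (n + 1)^|S| ≤ m` and `|S| + 1 ≤ m²`, and every weight `χ` of `GL_{m²}`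
vanishing outside `S`: `mult_χ ℂ[Δ(X₀₀^(m-n) per_n)] ≤ mult_χ ℂ[Δ(det_m)]`
(`orbitMultiplicity_le_of_weight_support` with
`linSubst_paddedPerFormLex_mem_orbitClosure_detFormLex`). BLMW 2011 §5.3 (inheritance). -/
theorem orbitMultiplicity_paddedPer_le_det_of_weight_support {n m : ℕ} [NeZero m] (hnm : n ≤ m)
    (S : Finset (MatIdx m)) (hm : 1 + n * (n + 1) ^ S.card ≤ m) (hS1 : S.card + 1 ≤ m * m)
    (χ : Weight (MatIdx m)) (hχ : ∀ i, i ∉ S → χ i = 0) :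
    orbitMultiplicity ℂ (paddedPerFormLex ℂ n m) m χ ≤ orbitMultiplicity ℂ (detFormLex ℂ m) m χ :=
  orbitMultiplicity_le_of_weight_support (detFormLex ℂ m) (paddedPerFormLex ℂ n m) (NeZero.ne m) S
    (fun A hA => linSubst_paddedPerFormLex_mem_orbitClosure_detFormLex hnm S hm hS1 A hA) χ hχ

/-- The dual weight `λ*` of a partition with at most `m²` parts vanishes at every lexicographic
index below the last `ℓ(λ)` ones. [folklore] -/
theorem dualOfPartition_toMatIdx_eq_zero_of_lt {m : ℕ} {d : ℕ} (lam : Nat.Partition d)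
    (i : Fin (m * m)) (hi : (i : ℕ) + lam.parts.card < m * m) :
    (Weight.dualOfPartition (m * m) lam).toMatIdx (matIdxEquiv m i) = 0 := by
  rw [Weight.toMatIdx]
  simp only [OrderIso.symm_apply_apply]
  rw [Weight.dualOfPartition, Weight.dual, Weight.ofPartition_apply, neg_eq_zero, Nat.cast_eq_zero,
    List.getD_eq_default]
  rw [Nat.Partition.length_sortedParts, Fin.val_rev]
  omega

/-- For `1 ≤ n` and `1 + n (n + 1) ^ ρ ≤ m`: `ρ + 2 ≤ m` (since `ρ + 1 ≤ 2 ^ ρ ≤ (n + 1) ^ ρ`).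
[folklore] -/
theorem card_add_two_le_of_bound {n m ρ : ℕ} (hn : 1 ≤ n) (hm : 1 + n * (n + 1) ^ ρ ≤ m) :
    ρ + 2 ≤ m := by
  have h1 : ρ < 2 ^ ρ := Nat.lt_two_pow_self
  have h2 : 2 ^ ρ ≤ (n + 1) ^ ρ := Nat.pow_le_pow_left (by omega) ρ
  have h3 : (n + 1) ^ ρ ≤ n * (n + 1) ^ ρ := Nat.le_mul_of_pos_left _ hn
  omega

/-- **No multiplicity obstruction on shapes of bounded length at polynomial padding.** For
`λ ⊢ m δ` with at most `m²` parts and `1 + n (n + 1)^{ℓ(λ)} ≤ m`: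
`mult_{λ*} ℂ[Δ(X₀₀^(m-n) per_n)] ≤ mult_{λ*} ℂ[Δ(det_m)] = K_m(λ*)`. (For `n = 0` the padded
permanent is `X₀₀^m ∈ Δ(det_m)` and there is nothing to prove; for `n ≥ 1` the dual weight `λ*`
is supported on the last `ℓ(λ)` lexicographic positions and
`orbitMultiplicity_paddedPer_le_det_of_weight_support` applies.) BLMW 2011 §5.3;
Kadish–Landsberg 2014. -/
theorem orbitMultiplicity_paddedPer_le_det_of_card_parts {n m : ℕ} [NeZero m] {δ : ℕ}
    (lam : Nat.Partition (m * δ)) (hcard : lam.parts.card ≤ m * m)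
    (hm : 1 + n * (n + 1) ^ lam.parts.card ≤ m) :
    orbitMultiplicity ℂ (paddedPerFormLex ℂ n m) m (Weight.dualOfPartition (m * m) lam).toMatIdx ≤
      orbitMultiplicity ℂ (detFormLex ℂ m) m (Weight.dualOfPartition (m * m) lam).toMatIdx := by
  classical
  rcases Nat.eq_zero_or_pos n with rfl | hn
  · exact orbitMultiplicity_paddedPer_le_det_of_two_pow_le (by have := NeZero.pos m; omega) _
  · set ρ := lam.parts.card with hρ
    have hρm : ρ + 2 ≤ m := card_add_two_le_of_bound hn hm
    have hmm : m ≤ m * m := Nat.le_mul_self m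
    have hnm : n ≤ m := by
      have : n ≤ n * (n + 1) ^ ρ := Nat.le_mul_of_pos_right _ (pow_pos (by omega) _)
      omega
    -- the last `ρ` lexicographic positions
    let S : Finset (MatIdx m) := Finset.univ.image fun t : Fin ρ =>
      matIdxEquiv m ⟨m * m - 1 - t, by omega⟩
    have hScard : S.card ≤ ρ := Finset.card_image_le.trans (by simp)
    have hm' : 1 + n * (n + 1) ^ S.card ≤ m :=
      le_trans (Nat.add_le_add_left (Nat.mul_le_mul_left n
        (Nat.pow_le_pow_right (by omega) hScard)) 1) hm
    have hS1 : S.card + 1 ≤ m * m := by omega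
    have hχ : ∀ i, i ∉ S → (Weight.dualOfPartition (m * m) lam).toMatIdx i = 0 := by
      intro i hi
      obtain ⟨i', rfl⟩ : ∃ i' : Fin (m * m), matIdxEquiv m i' = i :=
        ⟨(matIdxEquiv m).symm i, (matIdxEquiv m).apply_symm_apply i⟩
      by_cases hlt : (i' : ℕ) + ρ < m * m
      · exact dualOfPartition_toMatIdx_eq_zero_of_lt lam i' hlt
      · exfalso
        apply hi
        refine Finset.mem_image.mpr ⟨⟨m * m - 1 - i', by omega⟩, Finset.mem_univ _, ?_⟩
        congr 1
        exact Fin.ext (by simp; omega)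
    exact orbitMultiplicity_paddedPer_le_det_of_weight_support hnm S hm' hS1 _ hχ

/-- **`NoValuativeFlip` on shapes of bounded length (from `ValuativeBound`).** Given the route's
valuative bound `K_m(λ*) ≤ dim T_U(λ)` (stmt-ValiantsHypothesis-12625), the inequality of the kill
statement `NoValuativeFlip` (stmt-ValiantsHypothesis-12629, truncation `T_U(λ)` verbatim) holds for
every `n`, every `m ≥ 1 + n (n + 1)^{ℓ(λ)}`, every centre `(U, r)` with ranks `≤ r` on `U`, every
`δ` and every `λ ⊢ m δ` with at most `m²` parts: `mult_pp(λ*) ≤ K_m(λ*) ≤ dim T_U(λ)`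
(`orbitMultiplicity_paddedPer_le_det_of_card_parts`). -/
theorem noValuativeFlip_body_of_card_parts (hVB : ValuativeBound) {n : ℕ} (m : ℕ) [NeZero m]
    (U : Submodule ℂ (MatIdx m → ℂ)) (r : ℕ)
    (hU : ∀ u ∈ U, (Matrix.of fun a b : Fin m => u (toLex (a, b))).rank ≤ r)
    (δ : ℕ) (lam : Nat.Partition (m * δ)) (hcard : lam.parts.card ≤ m * m)
    (hm : 1 + n * (n + 1) ^ lam.parts.card ≤ m) :
    let χ : Literature.NumberTheory.DiophantineGeometry.Weight (Literature.NumberTheory.DiophantineGeometry.MatIdx m) := (Literature.NumberTheory.DiophantineGeometry.Weight.dualOfPartition (m * m) lam).toMatIdx; let T : Submodule ℂ (MvPolynomial (Literature.NumberTheory.DiophantineGeometry.MatIdx m × Literature.NumberTheory.DiophantineGeometry.MatIdx m) ℂ) := MvPolynomial.homogeneousSubmodule (Literature.NumberTheory.DiophantineGeometry.MatIdx m × Literature.NumberTheory.DiophantineGeometry.MatIdx m) ℂ (m * δ) ⊓ ((MvPolynomial.vanishingIdeal ℂ {p : Literature.NumberTheory.DiophantineGeometry.MatIdx m × Literature.NumberTheory.DiophantineGeometry.MatIdx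 m → ℂ | ∀ j : Literature.NumberTheory.DiophantineGeometry.MatIdx m, (fun i => p (j, i)) ∈ U}) ^ (δ * (m - r))).restrictScalars ℂ ⊓ (⨅ (M : Matrix (Literature.NumberTheory.DiophantineGeometry.MatIdx m) (Literature.NumberTheory.DiophantineGeometry.MatIdx m) ℂ) (_ : Literature.Computability.AlgebraicComplexity.linSubst (Literature.NumberTheory.DiophantineGeometry.MatIdx m) ℂ M (Literature.NumberTheory.DiophantineGeometry.detFormLex ℂ m) = Literature.NumberTheory.DiophantineGeometry.detFormLex ℂ m), LinearMap.ker ((MvPolynomial.aeval (R := ℂ) fun p : Literature.NumberTheory.DiophantineGeometry.MatIdx m × Literature.NumberTheory.DiophantineGeometry.MatIdx m => ∑ l : Literature.NumberTheory.DiophantineGeometry.MatIdx m, M l p.2 • MvPolynomial.X (p.1, l)).toLinearMap - LinearMap.id (R := ℂ) (M := MvPolynomial (Literature.NumberTheory.DiophantineGeometry.MatIdx m × Literature.NumberTheory.DiophantineGeometry.MatIdx m) ℂ))) ⊓ (⨅ (g : Matrix.GeneralLinearGroup (Literature.NumberTheory.DiophantineGeometry.MatIdx m) ℂ) (_ : Literature.NumberTheory.DiophantineGeometry.IsUpperTriangular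 g), LinearMap.ker ((MvPolynomial.aeval (R := ℂ) fun p : Literature.NumberTheory.DiophantineGeometry.MatIdx m × Literature.NumberTheory.DiophantineGeometry.MatIdx m => ∑ l : Literature.NumberTheory.DiophantineGeometry.MatIdx m, ((g⁻¹ : Matrix.GeneralLinearGroup (Literature.NumberTheory.DiophantineGeometry.MatIdx m) ℂ) : Matrix (Literature.NumberTheory.DiophantineGeometry.MatIdx m) (Literature.NumberTheory.DiophantineGeometry.MatIdx m) ℂ) p.1 l • MvPolynomial.X (l, p.2)).toLinearMap - Literature.NumberTheory.DiophantineGeometry.weightChar χ g • LinearMap.id (R := ℂ) (M := MvPolynomial (Literature.NumberTheory.DiophantineGeometry.MatIdx m × Literature.NumberTheory.DiophantineGeometry.MatIdx m) ℂ))); Literature.NumberTheory.DiophantineGeometry.orbitMultiplicity ℂ (Literature.NumberTheory.DiophantineGeometry.paddedPerFormLex ℂ n m) m χ ≤ Module.finrank ℂ ↥T := by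
  intro χ T
  exact (orbitMultiplicity_paddedPer_le_det_of_card_parts lam hcard hm).trans
    (hVB m U r hU δ lam hcard)

/-- Window arithmetic for the bounded-length theorem: for `2 ^ ρ + 1 ≤ n`,
`1 + n (n + 1) ^ ρ ≤ n ^ (ρ + 2)` (`(n + 1) ^ ρ ≤ 2 ^ ρ n ^ ρ` and `2 ^ ρ + 1 ≤ n`). [folklore] -/
theorem one_add_mul_succ_pow_le_pow {n ρ : ℕ} (hn : 2 ^ ρ + 1 ≤ n) :
    1 + n * (n + 1) ^ ρ ≤ n ^ (ρ + 2) := by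
  have h0 : 1 ≤ 2 ^ ρ := Nat.one_le_two_pow
  have hn2 : 2 ≤ n := le_trans (by omega) hn
  have h1 : (n + 1) ^ ρ ≤ (2 * n) ^ ρ := Nat.pow_le_pow_left (by omega) ρ
  have h2 : (2 * n) ^ ρ = 2 ^ ρ * n ^ ρ := mul_pow 2 n ρ
  have h3 : 1 ≤ n ^ (ρ + 1) := Nat.one_le_pow _ _ (by omega)
  calc 1 + n * (n + 1) ^ ρ ≤ n ^ (ρ + 1) + n * (2 ^ ρ * n ^ ρ) :=
        add_le_add h3 (Nat.mul_le_mul_left n (h1.trans_eq h2))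
    _ = (2 ^ ρ + 1) * n ^ (ρ + 1) := by ring
    _ ≤ n * n ^ (ρ + 1) := Nat.mul_le_mul_right _ hn
    _ = n ^ (ρ + 2) := by ring

/-- **`NoValuativeFlip` restricted to shapes with at most `ρ` rows holds with exponent `ρ + 2`**
(from `ValuativeBound`): for every `ρ` there are `c₀ = ρ + 2` and `n₀ = 2 ^ ρ + 1` such that for
all `n ≥ n₀`, all `m ≥ n ^ c₀`, every centre `(U, r)` with ranks `≤ r` on `U`, every `δ` and every
`λ ⊢ m δ` with at most `min ρ m²` parts, `mult_pp(λ*) ≤ dim T_U(λ)` (the statement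
`NoValuativeFlip` of stmt-ValiantsHypothesis-12629 with the extra hypothesis `ℓ(λ) ≤ ρ`; the body
is verbatim). Equivalently: a valuative flip (crux `ValuativeFlip`) at padding `m ≥ n ^ c` with
`n > 2 ^ (c - 2)` needs a shape with more than `c - 2` rows. -/
theorem noValuativeFlip_boundedLength (hVB : ValuativeBound) (ρ : ℕ) :
    ∃ c₀ n₀ : ℕ, ∀ n ≥ n₀, ∀ (m : ℕ) [NeZero m], n ^ c₀ ≤ m → ∀ (U : Submodule ℂ (Literature.NumberTheory.DiophantineGeometry.MatIdx m → ℂ)) (r : ℕ), (∀ u ∈ U, (Matrix.of fun a b : Fin m => u (toLex (a, b))).rank ≤ r) → ∀ (δ : ℕ) (lam : Nat.Partition (m * δ)), lam.parts.card ≤ ρ → lam.parts.card ≤ m * m → let χ : Literature.NumberTheory.DiophantineGeometry.Weight (Literature.NumberTheory.DiophantineGeometry.MatIdx m) := (Literature.NumberTheory.DiophantineGeometry.Weight.dualOfPartition (m * m) lam).toMatIdx; let T : Submodule ℂ (MvPolynomial (Literature.NumberTheory.DiophantineGeometry.MatIdx m × Literature.NumberTheory.DiophantineGeometry.MatIdx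 m) ℂ) := MvPolynomial.homogeneousSubmodule (Literature.NumberTheory.DiophantineGeometry.MatIdx m × Literature.NumberTheory.DiophantineGeometry.MatIdx m) ℂ (m * δ) ⊓ ((MvPolynomial.vanishingIdeal ℂ {p : Literature.NumberTheory.DiophantineGeometry.MatIdx m × Literature.NumberTheory.DiophantineGeometry.MatIdx m → ℂ | ∀ j : Literature.NumberTheory.DiophantineGeometry.MatIdx m, (fun i => p (j, i)) ∈ U}) ^ (δ * (m - r))).restrictScalars ℂ ⊓ (⨅ (M : Matrix (Literature.NumberTheory.DiophantineGeometry.MatIdx m) (Literature.NumberTheory.DiophantineGeometry.MatIdx m) ℂ) (_ : Literature.Computability.AlgebraicComplexity.linSubst (Literature.NumberTheory.DiophantineGeometry.MatIdx m) ℂ M (Literature.NumberTheory.DiophantineGeometry.detFormLex ℂ m) = Literature.NumberTheory.DiophantineGeometry.detFormLex ℂ m), LinearMap.ker ((MvPolynomial.aeval (R := ℂ) fun p : Literature.NumberTheory.DiophantineGeometry.MatIdx m × Literature.NumberTheory.DiophantineGeometry.MatIdx m => ∑ l : Literature.NumberTheory.DiophantineGeometry.MatIdx m, M l p.2 • MvPolynomial.X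 (p.1, l)).toLinearMap - LinearMap.id (R := ℂ) (M := MvPolynomial (Literature.NumberTheory.DiophantineGeometry.MatIdx m × Literature.NumberTheory.DiophantineGeometry.MatIdx m) ℂ))) ⊓ (⨅ (g : Matrix.GeneralLinearGroup (Literature.NumberTheory.DiophantineGeometry.MatIdx m) ℂ) (_ : Literature.NumberTheory.DiophantineGeometry.IsUpperTriangular g), LinearMap.ker ((MvPolynomial.aeval (R := ℂ) fun p : Literature.NumberTheory.DiophantineGeometry.MatIdx m × Literature.NumberTheory.DiophantineGeometry.MatIdx m => ∑ l : Literature.NumberTheory.DiophantineGeometry.MatIdx m, ((g⁻¹ : Matrix.GeneralLinearGroup (Literature.NumberTheory.DiophantineGeometry.MatIdx m) ℂ) : Matrix (Literature.NumberTheory.DiophantineGeometry.MatIdx m) (Literature.NumberTheory.DiophantineGeometry.MatIdx m) ℂ) p.1 l • MvPolynomial.X (l, p.2)).toLinearMap - Literature.NumberTheory.DiophantineGeometry.weightChar χ g • LinearMap.id (R := ℂ) (M := MvPolynomial (Literature.NumberTheory.DiophantineGeometry.MatIdx m × Literature.NumberTheory.DiophantineGeometry.MatIdx m) ℂ))); Literature.NumberTheory.DiophantineGeometry.orbitMultiplicity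 ℂ (Literature.NumberTheory.DiophantineGeometry.paddedPerFormLex ℂ n m) m χ ≤ Module.finrank ℂ ↥T := by
  refine ⟨ρ + 2, 2 ^ ρ + 1, fun n hn m _ hm U r hU δ lam hρ hcard => ?_⟩
  have hbound : 1 + n * (n + 1) ^ lam.parts.card ≤ m := by
    refine le_trans ?_ ((one_add_mul_succ_pow_le_pow hn).trans hm)
    exact Nat.add_le_add_left (Nat.mul_le_mul_left n (Nat.pow_le_pow_right (by omega) hρ)) 1
  exact noValuativeFlip_body_of_card_parts hVB m U r hU δ lam hcard hbound

/-- **`GctNoMultBarrier` on shapes of bounded length (unconditional).** For every `ρ` there are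
`c₀ = ρ + 2` and `n₀ = 2 ^ ρ + 1` such that for all `n ≥ n₀`, all `m ≥ n ^ c₀` and every
`λ ⊢ m δ` with at most `min ρ m²` parts, the multiplicity of `λ*` in `ℂ[Δ(X₀₀^(m-n) per_n)]` is at
most its multiplicity `K_m(λ*)` in `ℂ[Δ(det_m)]`: the multiplicity no-go statement
`GCTMult.GctNoMultBarrier` (stmt-ValiantsHypothesis-0890) restricted to shapes of bounded length —
multiplicity obstructions at polynomial padding `n ^ c` need more than `c - 2` rows.
BLMW 2011 §5.3 (inheritance) with Valiant universality. -/
theorem gctNoMultBarrier_boundedLength (ρ : ℕ) :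
    ∃ c₀ n₀ : ℕ, ∀ n ≥ n₀, ∀ (m : ℕ) [NeZero m], n ^ c₀ ≤ m →
      ∀ (δ : ℕ) (lam : Nat.Partition (m * δ)), lam.parts.card ≤ ρ → lam.parts.card ≤ m * m →
        orbitMultiplicity ℂ (paddedPerFormLex ℂ n m) m (Weight.dualOfPartition (m * m) lam).toMatIdx ≤
          orbitMultiplicity ℂ (detFormLex ℂ m) m (Weight.dualOfPartition (m * m) lam).toMatIdx := by
  refine ⟨ρ + 2, 2 ^ ρ + 1, fun n hn m _ hm δ lam hρ hcard => ?_⟩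
  have hbound : 1 + n * (n + 1) ^ lam.parts.card ≤ m := by
    refine le_trans ?_ ((one_add_mul_succ_pow_le_pow hn).trans hm)
    exact Nat.add_le_add_left (Nat.mul_le_mul_left n (Nat.pow_le_pow_right (by omega) hρ)) 1
  exact orbitMultiplicity_paddedPer_le_det_of_card_parts lam hcard hbound

end Summit.ValiantsHypothesis.ValiantsHypothesis.Theorems.NoValuativeFlip

end
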